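import Literature.NumberTheory.LFunctions.WeilCombAutocorrelationBump
import Literature.NumberTheory.LFunctions.DivisorCombFactorisation
import Mathlib.MeasureTheory.Measure.Haar.NormedSpace
import HarnessLib

/-!
# The autocorrelation of a `ζ`-mollified resonator comb as a sum of bump autocorrelations

Topic `Literature/NumberTheory/LFunctions`.  For the comb
`g(u) = ∑_{m ≤ LM} a_m b((u - log m) M/κ)`, `a_m = ∑_{k ∣ m, k ≤ M} α(m/k)/√k` (real resonator `α`
supported on `[1, L]`, real bump `b`), the autocorrelation `K = g ⋆ g̃` is the real sum
`K(y) = (κ/M) ∑_{ℓ,ℓ' ≤ L} α_ℓ α_ℓ' ∑_{k,k' ≤ M} B((y + log(ℓ'k') - log(ℓk)) M/κ)/√(kk')`,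
`B(v) = ∫ b(u) b(u-v) du` (`Literature/NumberTheory/LFunctions/WeilCombAutocorrelationBump.lean`):

* `comb_eq_ofReal` — the comb is real: `g(u) = ∑_{ℓ ≤ L, k ≤ M} (α_ℓ/√k) b((u - log(ℓk)) M/κ)`;
* `integral_tooth_mul_tooth` — `∫ b((u-A)λ) b((u-y-A')λ) du = λ⁻¹ B((y + A' - A)λ)`;
* `weilConv_comb_eq` — the displayed formula for `K(y)` (as a complex number with zero imaginary
  part).

Everything is proved; no named facts.
-/

noncomputable section

open MeasureTheory Set Complex Finset
open scoped ComplexConjugate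

namespace Literature.NumberTheory.LFunctions

/-! ## Teeth -/

/-- A dilated translate of a compactly supported function has compact support. [folklore] -/
theorem hasCompactSupport_tooth {b : ℝ → ℝ} (hbc : HasCompactSupport b) (A : ℝ) {lam : ℝ}
    (hlam : lam ≠ 0) : HasCompactSupport fun u ↦ b ((u - A) * lam) := by
  have e : (fun u ↦ b ((u - A) * lam))
      = b ∘ ((Homeomorph.addRight (-A)).trans (Homeomorph.mulRight₀ lam hlam)) := by
    funext u; simp [sub_eq_add_neg]
  rw [e]
  exact hbc.comp_homeomorph _

/-- **One pair of teeth**: `∫ b((u-A)λ) b((u-y-A')λ) du = λ⁻¹ ∫ b(s) b(s - (y + A' - A)λ) ds` for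
`λ > 0` (translate by `A`, dilate by `λ`). [folklore] -/
theorem integral_tooth_mul_tooth (b : ℝ → ℝ) (A A' y : ℝ) {lam : ℝ} (hlam : 0 < lam) :
    ∫ u, b ((u - A) * lam) * b ((u - y - A') * lam)
      = lam⁻¹ * ∫ s, b s * b (s - (y + A' - A) * lam) := by
  set F : ℝ → ℝ := fun s ↦ b s * b (s - (y + A' - A) * lam) with hF
  have h1 : (fun u ↦ b ((u - A) * lam) * b ((u - y - A') * lam)) = fun u ↦ F ((u - A) * lam) := by
    funext u
    simp only [hF]
    congr 2
    ring
  have h2 : ∫ u, F ((u - A) * lam) = ∫ u, F (u * lam) := by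
    have := integral_sub_right_eq_self (fun u ↦ F (u * lam)) (μ := volume) A
    exact this
  have h3 : ∫ u, F (u * lam) = lam⁻¹ * ∫ s, F s := by
    have e : (fun u ↦ F (u * lam)) = fun u ↦ F (lam * u) := by funext u; rw [mul_comm]
    rw [e, MeasureTheory.Measure.integral_comp_mul_left F lam, smul_eq_mul,
      abs_of_pos (inv_pos.2 hlam)]
  rw [h1, h2, h3]

/-! ## The comb is real -/

section Comb

variable {α : ℕ → ℝ} {L : ℕ}

/-- **The comb is real**: for `α` vanishing above `L`,
`∑_{m ≤ LM} a_m b((u - log m) M/κ) = ∑_{ℓ ≤ L} ∑_{k ≤ M} (α_ℓ/√k) b((u - log(ℓk)) M/κ)`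
(as complex numbers; `Literature.NumberTheory.LFunctions.sum_divisorConv_mul_eq`). [folklore] -/
theorem comb_eq_ofReal (hα : ∀ m, L < m → α m = 0) (b : ℝ → ℝ) (M : ℕ) (κ u : ℝ) :
    ∑ m ∈ Finset.range (L * M + 1),
        ((∑ k ∈ (Nat.divisors m).filter (· ≤ M), α (m / k) / Real.sqrt k : ℝ) : ℂ) *
          ((b ((u - Real.log m) * (M : ℝ) / κ) : ℝ) : ℂ)
      = ((∑ ℓ ∈ Finset.Icc 1 L, ∑ k ∈ Finset.Icc 1 M,
          α ℓ / Real.sqrt k * b ((u - Real.log ((ℓ : ℝ) * k)) * (M : ℝ) / κ) : ℝ) : ℂ) := by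
  rw [sum_divisorConv_mul_eq hα M (fun m ↦ ((b ((u - Real.log m) * (M : ℝ) / κ) : ℝ) : ℂ))]
  push_cast
  rfl

/-- **The autocorrelation of the comb.** With `g(u) = ∑_{m ≤ LM} a_m b((u - log m) M/κ)` complexified,
`(g ⋆ g̃)(y) = (κ/M) ∑_{ℓ,ℓ' ≤ L} α_ℓ α_ℓ' ∑_{k,k' ≤ M} B((y + log(ℓ'k') - log(ℓk)) M/κ)/(√k √k')`,
`B(v) = ∫ b(u) b(u-v) du` (`b` continuous of compact support, `κ, M > 0`). [folklore] -/
theorem weilConv_comb_eq (hα : ∀ m, L < m → α m = 0) {b : ℝ → ℝ} (hb : Continuous b)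
    (hbc : HasCompactSupport b) {M : ℕ} (hM : 0 < M) {κ : ℝ} (hκ : 0 < κ) (y : ℝ) :
    weilConv
        (fun u ↦ ∑ m ∈ Finset.range (L * M + 1),
          ((∑ k ∈ (Nat.divisors m).filter (· ≤ M), α (m / k) / Real.sqrt k : ℝ) : ℂ) *
            ((b ((u - Real.log m) * (M : ℝ) / κ) : ℝ) : ℂ))
        (weilReflect fun u ↦ ∑ m ∈ Finset.range (L * M + 1),
          ((∑ k ∈ (Nat.divisors m).filter (· ≤ M), α (m / k) / Real.sqrt k : ℝ) : ℂ) *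
            ((b ((u - Real.log m) * (M : ℝ) / κ) : ℝ) : ℂ)) y
      = ((κ / M * ∑ ℓ ∈ Finset.Icc 1 L, ∑ ℓ' ∈ Finset.Icc 1 L, α ℓ * α ℓ' *
          ∑ k ∈ Finset.Icc 1 M, ∑ k' ∈ Finset.Icc 1 M,
            (∫ s, b s * b (s - (y + Real.log ((ℓ' : ℝ) * k') - Real.log ((ℓ : ℝ) * k)) * (M : ℝ) / κ))
              / (Real.sqrt k * Real.sqrt k') : ℝ) : ℂ) := by
  have hMR : (0 : ℝ) < M := by exact_mod_cast hM
  set lam : ℝ := (M : ℝ) / κ with hlam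
  have hlam0 : 0 < lam := by positivity
  -- the real comb
  set gr : ℝ → ℝ := fun u ↦ ∑ ℓ ∈ Finset.Icc 1 L, ∑ k ∈ Finset.Icc 1 M,
    α ℓ / Real.sqrt k * b ((u - Real.log ((ℓ : ℝ) * k)) * (M : ℝ) / κ) with hgr
  have hg : (fun u ↦ ∑ m ∈ Finset.range (L * M + 1),
      ((∑ k ∈ (Nat.divisors m).filter (· ≤ M), α (m / k) / Real.sqrt k : ℝ) : ℂ) *
        ((b ((u - Real.log m) * (M : ℝ) / κ) : ℝ) : ℂ)) = fun u ↦ ((gr u : ℝ) : ℂ) := by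
    funext u; exact comb_eq_ofReal hα b M κ u
  rw [hg]
  -- the autocorrelation of a real function
  have hconv : weilConv (fun u ↦ ((gr u : ℝ) : ℂ)) (weilReflect fun u ↦ ((gr u : ℝ) : ℂ)) y
      = ((∫ u, gr u * gr (u - y) : ℝ) : ℂ) := weilConv_ofReal_eq gr y
  rw [hconv]
  congr 1
  -- expand the product of the two double sums (over the product index set)
  set P : Finset (ℕ × ℕ) := Finset.Icc 1 L ×ˢ Finset.Icc 1 M with hP
  set tooth : ℕ × ℕ → ℝ → ℝ := fun q u ↦
    α q.1 / Real.sqrt q.2 * b ((u - Real.log ((q.1 : ℝ) * q.2)) * (M : ℝ) / κ) with htooth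
  have hgrP : ∀ u, gr u = ∑ q ∈ P, tooth q u := by
    intro u
    rw [hgr, hP, Finset.sum_product]
  have hprod : ∀ u, gr u * gr (u - y) = ∑ q ∈ P, ∑ q' ∈ P, tooth q u * tooth q' (u - y) := by
    intro u
    rw [hgrP, hgrP, Finset.sum_mul_sum]
  simp_rw [hprod]
  -- integrability of each term
  have hint : ∀ q q' : ℕ × ℕ, Integrable fun u ↦ tooth q u * tooth q' (u - y) := by
    intro q q'
    have hc1 : Continuous fun u ↦ tooth q u := by
      simp only [htooth]
      exact continuous_const.mul (hb.comp (by fun_prop))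
    have hc2 : Continuous fun u ↦ tooth q' (u - y) := by
      simp only [htooth]
      exact continuous_const.mul (hb.comp (by fun_prop))
    have hcs : HasCompactSupport fun u ↦ tooth q u := by
      simp only [htooth]
      have h1 : HasCompactSupport fun u ↦ b ((u - Real.log ((q.1 : ℝ) * q.2)) * (M : ℝ) / κ) := by
        have := hasCompactSupport_tooth hbc (Real.log ((q.1 : ℝ) * q.2)) hlam0.ne'
        simpa only [hlam, mul_div_assoc] using this
      exact h1.mul_left
    exact (hc1.mul hc2).integrable_of_hasCompactSupport hcs.mul_right
  rw [integral_finsetSum _ fun q _ ↦ integrable_finsetSum _ fun q' _ ↦ hint q q']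
  simp_rw [integral_finsetSum _ fun q' _ ↦ hint _ q']
  -- evaluate each integral
  have hval : ∀ q q' : ℕ × ℕ, ∫ u, tooth q u * tooth q' (u - y)
      = κ / M * (α q.1 * α q'.1 *
          ((∫ s, b s * b (s - (y + Real.log ((q'.1 : ℝ) * q'.2) - Real.log ((q.1 : ℝ) * q.2)) * (M : ℝ) / κ))
            / (Real.sqrt q.2 * Real.sqrt q'.2))) := by
    intro q q'
    simp only [htooth]
    have e1 : ∀ u, α q.1 / Real.sqrt q.2 * b ((u - Real.log ((q.1 : ℝ) * q.2)) * (M : ℝ) / κ) *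
        (α q'.1 / Real.sqrt q'.2 * b ((u - y - Real.log ((q'.1 : ℝ) * q'.2)) * (M : ℝ) / κ))
        = α q.1 / Real.sqrt q.2 * (α q'.1 / Real.sqrt q'.2) *
          (b ((u - Real.log ((q.1 : ℝ) * q.2)) * lam) * b ((u - y - Real.log ((q'.1 : ℝ) * q'.2)) * lam)) := by
      intro u; simp only [hlam, mul_div_assoc]; ring
    simp_rw [e1]
    rw [integral_const_mul, integral_tooth_mul_tooth b _ _ y hlam0]
    have hlaminv : lam⁻¹ = κ / M := by rw [hlam, inv_div]
    have harg : (y + Real.log ((q'.1 : ℝ) * q'.2) - Real.log ((q.1 : ℝ) * q.2)) * lam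
        = (y + Real.log ((q'.1 : ℝ) * q'.2) - Real.log ((q.1 : ℝ) * q.2)) * (M : ℝ) / κ := by
      rw [hlam, mul_div_assoc]
    rw [hlaminv, harg]
    ring
  simp_rw [hval]
  rw [hP, Finset.sum_product]
  simp_rw [Finset.sum_product, Finset.mul_sum]
  refine Finset.sum_congr rfl fun ℓ _ ↦ ?_
  rw [Finset.sum_comm]

end Comb

end Literature.NumberTheory.LFunctions
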